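import Summits.Ventures.HodgeRepro2.T5CyclotomicFourInertPrime
import Summits.Ventures.HodgeRepro2.T5CyclotomicSevenSplitTwo

/-!
# Every rational prime `p ≡ 1 (mod 4)` gives a place of `ℚ(i)⁺` with two places of `ℚ(i)` above it

Tier-5 support N3 / §G-N4.2 (seat p3, gen 78). File 258's split family for the toy field: every rational prime `p`
with `orderOf (p : ZMod 4) = 1`, i.e. `p ≡ 1 (mod 4)` (`5, 13, 17, 29, …`), has `(p)` prime in `𝓞_{ℚ(i)⁺}` (of
norm `p`) with exactly two places of `ℚ(i)` above it, and the record's `H(U(1 ⊗ H₀), K_{(p)})` is commutative —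
file 258's argument verbatim with `7 ↦ 4`, `3 ↦ 1`, `p³ ↦ p`:

* `not_dvd_four_of_orderOf_eq_one`, `absNorm_span_natCast_plus` (`N((p)) = p` in `𝓞_{ℚ(i)⁺}`);
* `inertiaDeg_of_liesOver_of_orderOf_eq_one`, `ramificationIdx_of_liesOver_of_orderOf_eq_one`,
  `absNorm_of_liesOver_of_orderOf_eq_one` — `f = 1`, `e = 1`, `N(P) = p` for every prime `P` above `p`;
* `wOf` / `vOf`, `inertiaDeg_under_eq_one`, `inertiaDeg_under_int`, `absNorm_under`, **`under_eq_span_natCast`**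
  — the contraction of `P` IS `(p)`;
* **`isPrime_span_natCast_plus`**, `vSplit`, `absNorm_vSplit` — the place `(p)` of `ℚ(i)⁺`, `N(v) = p`;
* `ramificationIdx_under_eq_one`, `ncard_primesOver_vOf`, **`ncard_primesOver_vSplit`**, `exists_ne_liesOver_vSplit`
  — exactly two places of `ℚ(i)` above `(p)`;
* **`heckeAlgebra_mul_comm_record_four_split`**, `exists_generators_and_heckeAlgebra_mul_comm_record_four_split`
  — `H(U(1 ⊗ H₀), K_{(p)})` is commutative on `ℚ(i)` at every such place;
* the instances `p = 5` (`ncard_primesOver_vSplit_five` — file 250 re-derived) and `p = 13`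
  (`ncard_primesOver_vSplit_thirteen_and_absNorm`).

§8(d): uses an L-value-free non-vanishing device: NO.
-/

open Matrix NumberField NumberField.IsCMField IsDedekindDomain IsDedekindDomain.HeightOneSpectrum Module
open scoped TensorProduct Pointwise
open Summit.Ventures.HodgeRepro2.T5UnitaryGroupForm Summit.Ventures.HodgeRepro2.T5UnitaryHeckeAdjoint
  Summit.Ventures.HodgeRepro2.T5HeckePermutationModule Summit.Ventures.HodgeRepro2.T5RecordHyperspecial
  Summit.Ventures.HodgeRepro2.T5GlobalLatticeAlmostAll Summit.Ventures.HodgeRepro2.T5FinitePlaceSplitClassification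
  Summit.Ventures.HodgeRepro2.T5RecordSatakeToy Summit.Ventures.HodgeRepro2.T5RecordSatakeSplitToy
  Summit.Ventures.HodgeRepro2.T5CyclotomicSevenInertThree Summit.Ventures.HodgeRepro2.T5CMFieldSquareDatum
  Summit.Ventures.HodgeRepro2.T5FinitePlaceSplitIff Summit.Ventures.HodgeRepro2.T5SplitPlaceUnitaryGroup
  Summit.Ventures.HodgeRepro2.T5RecordSatakeInert Summit.Ventures.HodgeRepro2.T5FinitePlaceCM
  Summit.Ventures.HodgeRepro2.T5CyclotomicFourInertPrime Summit.Ventures.HodgeRepro2.T5CyclotomicSevenSplitTwo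
  Summit.Ventures.HodgeRepro2.T5RecordSatakeInertToy Summit.Ventures.HodgeRepro2.T5CMCensusToy
  Summit.Ventures.HodgeRepro2.T5RecordSatakeInertToyDegree

namespace Summit.Ventures.HodgeRepro2.T5CyclotomicFourSplitPrime

section Arithmetic

variable (p : ℕ) [hp : Fact p.Prime]

/-- A prime of order `1` modulo `4` is odd (the class of `2` modulo `4` is nilpotent, of order `0`). -/
theorem not_dvd_four_of_orderOf_eq_one (h1 : orderOf (p : ZMod (2 ^ 2)) = 1) : ¬ p ∣ 2 ^ 2 := by
  intro hdvd
  have hp2 : p = 2 := (Nat.prime_dvd_prime_iff_eq hp.out Nat.prime_two).mp (hp.out.dvd_of_dvd_pow hdvd)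
  rw [hp2] at h1
  have h0 : orderOf ((2 : ℕ) : ZMod (2 ^ 2)) = 0 := orderOf_eq_zero_iff'.mpr fun n hn => by
    intro h
    have h' : ((2 : ℕ) : ZMod (2 ^ 2)) ^ n * ((2 : ℕ) : ZMod (2 ^ 2)) ^ n = 1 := by rw [h, one_mul]
    rw [← pow_add] at h'
    have hdvd2 : ((2 : ℕ) : ZMod (2 ^ 2)) ^ 2 ∣ ((2 : ℕ) : ZMod (2 ^ 2)) ^ (n + n) :=
      pow_dvd_pow _ (by omega)
    rw [h'] at hdvd2
    have hz : ((2 : ℕ) : ZMod (2 ^ 2)) ^ 2 = 0 := by decide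
    rw [hz] at hdvd2
    exact absurd (zero_dvd_iff.mp hdvd2) (by decide)
  rw [h0] at h1
  exact absurd h1 (by norm_num)

end Arithmetic

section Seven

variable (K : Type*) [Field K] [CharZero K] [IsCyclotomicExtension {2 ^ 2} ℚ K]
variable (p : ℕ) [hp : Fact p.Prime] (h1 : orderOf (p : ZMod (2 ^ 2)) = 1)

omit hp in
/-- `N((p)) = p` in `𝓞_{ℚ(i)⁺}`. -/
theorem absNorm_span_natCast_plus :
    haveI := numberField K; haveI := isCMField_four K
    Ideal.absNorm (Ideal.span {(p : 𝓞 (maximalRealSubfield K))}) = p := by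
  haveI := numberField K
  haveI := isCMField_four K
  rw [Ideal.absNorm_span_natCast, RingOfIntegers.rank, finrank_rat_maximalRealSubfield K, pow_one]

variable (P : Ideal (𝓞 K)) [P.IsPrime] [P.LiesOver (Ideal.span {(p : ℤ)})]

include h1 in
/-- Every prime of `𝓞_{ℚ(i)}` above `p` has inertia degree `orderOf (p mod 4) = 1` (Mathlib). -/
theorem inertiaDeg_of_liesOver_of_orderOf_eq_one :
    haveI := numberField K
    P.inertiaDeg ℤ = 1 := by
  haveI := numberField K
  rw [IsCyclotomicExtension.Rat.inertiaDeg_eq_of_not_dvd (m := 2 ^ 2) p K P (not_dvd_four_of_orderOf_eq_one p h1),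
    h1]

include h1 in
/-- Every prime of `𝓞_{ℚ(i)}` above `p` is unramified over `ℤ` (Mathlib). -/
theorem ramificationIdx_of_liesOver_of_orderOf_eq_one :
    haveI := numberField K
    P.ramificationIdx ℤ = 1 := by
  haveI := numberField K
  exact IsCyclotomicExtension.Rat.ramificationIdx_eq_of_not_dvd (m := 2 ^ 2) p K P
    (not_dvd_four_of_orderOf_eq_one p h1)

include h1 in
/-- Every prime of `𝓞_{ℚ(i)}` above `p` has norm `p`. -/
theorem absNorm_of_liesOver_of_orderOf_eq_one :
    haveI := numberField K
    Ideal.absNorm P = p := by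
  haveI := numberField K
  have h := Ideal.absNorm_pow_inertiaDeg (Ideal.span {(p : ℤ)}) P
  rw [absNorm_span_natCast_int, inertiaDeg_of_liesOver_of_orderOf_eq_one K p h1 P, pow_one] at h
  exact h.symm

omit [CharZero K] [IsCyclotomicExtension {2 ^ 2} ℚ K] hp [P.IsPrime] in
/-- `p ∈ P`. -/
theorem natCast_mem_of_liesOver : (p : 𝓞 K) ∈ P := by
  have h2 : (p : ℤ) ∈ Ideal.span {(p : ℤ)} := Ideal.mem_span_singleton_self (p : ℤ)
  rw [Ideal.mem_of_liesOver P (Ideal.span {(p : ℤ)}) p, map_natCast] at h2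
  exact h2

omit [CharZero K] [IsCyclotomicExtension {2 ^ 2} ℚ K] hp [P.IsPrime] in
/-- `p ∈ P ∩ 𝓞_{ℚ(i)⁺}`. -/
theorem natCast_mem_under_of_liesOver :
    (p : 𝓞 (maximalRealSubfield K)) ∈ P.under (𝓞 (maximalRealSubfield K)) := by
  rw [Ideal.mem_under, map_natCast]
  exact natCast_mem_of_liesOver K p P

/-- A prime `P` above `p` as a place of `ℚ(i)`. -/
noncomputable def wOf : HeightOneSpectrum (𝓞 K) where
  asIdeal := P
  isPrime := inferInstance
  ne_bot := fun h => by
    have h2 := natCast_mem_of_liesOver K p P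
    rw [h, Ideal.mem_bot] at h2
    exact Nat.cast_ne_zero.mpr hp.out.ne_zero h2

/-- The contraction of `P` as a place of `ℚ(i)⁺`. -/
noncomputable def vOf : HeightOneSpectrum (𝓞 (maximalRealSubfield K)) where
  asIdeal := P.under (𝓞 (maximalRealSubfield K))
  isPrime := inferInstance
  ne_bot := fun h => by
    have h2 := natCast_mem_under_of_liesOver K p P
    rw [h, Ideal.mem_bot] at h2
    exact Nat.cast_ne_zero.mpr hp.out.ne_zero h2

omit [IsCyclotomicExtension {2 ^ 2} ℚ K] in
/-- The ideal of `wOf`. -/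
theorem wOf_asIdeal : (wOf K p P).asIdeal = P := rfl

omit [IsCyclotomicExtension {2 ^ 2} ℚ K] in
/-- The ideal of `vOf`. -/
theorem vOf_asIdeal : (vOf K p P).asIdeal = P.under (𝓞 (maximalRealSubfield K)) := rfl

/-- `wOf` lies over `vOf`. -/
instance liesOver_vOf : (wOf K p P).asIdeal.LiesOver (vOf K p P).asIdeal := ⟨rfl⟩

include h1 in
/-- **`f(P/v) = 1`**: `1 = f(P/p) = f(v/p) · f(P/v)` (the tower law). -/
theorem inertiaDeg_under_eq_one :
    haveI := numberField K; haveI := isCMField_four K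
    (wOf K p P).asIdeal.inertiaDeg (𝓞 (maximalRealSubfield K)) = 1 := by
  haveI := numberField K
  haveI := isCMField_four K
  have htower := Ideal.inertiaDeg_tower (R := ℤ) (vOf K p P).asIdeal (wOf K p P).asIdeal
  have h1' : (wOf K p P).asIdeal.inertiaDeg ℤ = 1 := inertiaDeg_of_liesOver_of_orderOf_eq_one K p h1 P
  rw [h1'] at htower
  exact Nat.eq_one_of_mul_eq_one_left htower.symm

include h1 in
/-- `f(v/p) = 1`. -/
theorem inertiaDeg_under_int :
    haveI := numberField K; haveI := isCMField_four K
    (vOf K p P).asIdeal.inertiaDeg ℤ = 1 := by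
  haveI := numberField K
  haveI := isCMField_four K
  have htower := Ideal.inertiaDeg_tower (R := ℤ) (vOf K p P).asIdeal (wOf K p P).asIdeal
  have h1' : (wOf K p P).asIdeal.inertiaDeg ℤ = 1 := inertiaDeg_of_liesOver_of_orderOf_eq_one K p h1 P
  rw [h1', inertiaDeg_under_eq_one K p h1 P, mul_one] at htower
  exact htower.symm

include h1 in
/-- `N(v) = p` for the contraction `v` of a prime above `p`. -/
theorem absNorm_under :
    haveI := numberField K; haveI := isCMField_four K
    Ideal.absNorm (vOf K p P).asIdeal = p := by
  haveI := numberField K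
  haveI := isCMField_four K
  haveI : (vOf K p P).asIdeal.LiesOver (Ideal.span {(p : ℤ)}) := by
    rw [vOf_asIdeal]
    exact Ideal.LiesOver.tower_bot P (P.under (𝓞 (maximalRealSubfield K))) (Ideal.span {(p : ℤ)})
  have h := Ideal.absNorm_pow_inertiaDeg (Ideal.span {(p : ℤ)}) (vOf K p P).asIdeal
  rw [absNorm_span_natCast_int, inertiaDeg_under_int K p h1 P, pow_one] at h
  exact h.symm

include h1 in
/-- **The contraction of every prime above `p` is `(p)`**: `(p) ≤ v` and both have norm `p`. -/
theorem under_eq_span_natCast :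
    haveI := numberField K; haveI := isCMField_four K
    (vOf K p P).asIdeal = Ideal.span {(p : 𝓞 (maximalRealSubfield K))} := by
  haveI := numberField K
  haveI := isCMField_four K
  refine (eq_of_le_of_absNorm_eq ?_
    ((Ideal.span_singleton_eq_bot).not.mpr (Nat.cast_ne_zero.mpr hp.out.ne_zero)) ?_).symm
  · rw [Ideal.span_le, Set.singleton_subset_iff, SetLike.mem_coe, vOf_asIdeal]
    exact natCast_mem_under_of_liesOver K p P
  · rw [absNorm_span_natCast_plus K p, absNorm_under K p h1 P]

end Seven

section Place

variable (K : Type*) [Field K] [CharZero K] [IsCyclotomicExtension {2 ^ 2} ℚ K]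
variable (p : ℕ) [hp : Fact p.Prime] (h1 : orderOf (p : ZMod (2 ^ 2)) = 1)

include h1 in
/-- **`(p)` is a prime of `𝓞_{ℚ(i)⁺}`** for `p` of order `1` modulo `4`: it is the contraction of any prime of
`𝓞_{ℚ(i)}` above `p`. -/
theorem isPrime_span_natCast_plus :
    haveI := numberField K; haveI := isCMField_four K
    (Ideal.span {(p : 𝓞 (maximalRealSubfield K))}).IsPrime := by
  haveI := numberField K
  haveI := isCMField_four K
  haveI : (Ideal.span {(p : ℤ)}).IsPrime :=
    (Ideal.span_singleton_prime (Nat.cast_ne_zero.mpr hp.out.ne_zero)).mpr (Nat.prime_iff_prime_int.mp hp.out)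
  obtain ⟨⟨P, hP, hPo⟩⟩ := Ideal.nonempty_primesOver (S := 𝓞 K) (Ideal.span {(p : ℤ)})
  rw [← under_eq_span_natCast K p h1 P]
  exact (vOf K p P).isPrime

/-- **The place `(p)` of `ℚ(i)⁺`** for a prime `p` of order `1` modulo `4`. -/
noncomputable def vSplit : HeightOneSpectrum (𝓞 (maximalRealSubfield K)) :=
  haveI := numberField K
  haveI := isCMField_four K
  { asIdeal := Ideal.span {(p : 𝓞 (maximalRealSubfield K))}
    isPrime := isPrime_span_natCast_plus K p h1
    ne_bot := (Ideal.span_singleton_eq_bot).not.mpr (Nat.cast_ne_zero.mpr hp.out.ne_zero) }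

/-- The ideal of `vSplit` is `(p)`. -/
theorem vSplit_asIdeal : (vSplit K p h1).asIdeal = Ideal.span {(p : 𝓞 (maximalRealSubfield K))} := rfl

/-- `N(vSplit) = p`. -/
theorem absNorm_vSplit :
    haveI := numberField K; haveI := isCMField_four K
    Ideal.absNorm (vSplit K p h1).asIdeal = p := by
  haveI := numberField K
  haveI := isCMField_four K
  rw [vSplit_asIdeal]
  exact absNorm_span_natCast_plus K p

variable (P : Ideal (𝓞 K)) [P.IsPrime] [P.LiesOver (Ideal.span {(p : ℤ)})]

include h1 in
/-- **`e(P/v) = 1`**: `1 = e(P/p) = e(v/p) · e(P/v)` (the tower law, `𝓞_{ℚ(i)}` being flat over the Dedekind domain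
`𝓞_{ℚ(i)⁺}`). -/
theorem ramificationIdx_under_eq_one :
    haveI := numberField K; haveI := isCMField_four K
    (wOf K p P).asIdeal.ramificationIdx (𝓞 (maximalRealSubfield K)) = 1 := by
  haveI := numberField K
  haveI := isCMField_four K
  have htower := Ideal.ramificationIdx_tower (R := ℤ) (vOf K p P).asIdeal (wOf K p P).asIdeal
  have h1 : (wOf K p P).asIdeal.ramificationIdx ℤ = 1 := ramificationIdx_of_liesOver_of_orderOf_eq_one K p h1 P
  rw [h1] at htower
  exact Nat.eq_one_of_mul_eq_one_left htower.symm

include h1 in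
/-- **Exactly two places of `ℚ(i)` above the contraction of a prime above `p`**: the local degree
`[K_P : K⁺_v] = e(P/v) f(P/v) = 1`, and a local degree `1` means two places (file T5FinitePlaceSplitIff). -/
theorem ncard_primesOver_vOf :
    haveI := numberField K; haveI := isCMField_four K
    ((vOf K p P).asIdeal.primesOver (𝓞 K)).ncard = 2 := by
  haveI := numberField K
  haveI := isCMField_four K
  obtain ⟨θ, y, hθ, hy⟩ := exists_sq_eq_and_complexConj_ne K
  refine (finrank_eq_one_iff_ncard_primesOver_eq_two K (vOf K p P) (wOf K p P) hθ hy).mp ?_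
  rw [← ramificationIdx_mul_inertiaDeg_eq_finrank K (vOf K p P) (wOf K p P) hθ hy,
    ramificationIdx_under_eq_one K p h1 P, inertiaDeg_under_eq_one K p h1 P]

omit P in
include h1 in
/-- **Exactly two places of `ℚ(i)` above `(p)`.** -/
theorem ncard_primesOver_vSplit :
    haveI := numberField K; haveI := isCMField_four K
    ((vSplit K p h1).asIdeal.primesOver (𝓞 K)).ncard = 2 := by
  haveI := numberField K
  haveI := isCMField_four K
  haveI : (Ideal.span {(p : ℤ)}).IsPrime :=
    (Ideal.span_singleton_prime (Nat.cast_ne_zero.mpr hp.out.ne_zero)).mpr (Nat.prime_iff_prime_int.mp hp.out)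
  obtain ⟨⟨P, hP, hPo⟩⟩ := Ideal.nonempty_primesOver (S := 𝓞 K) (Ideal.span {(p : ℤ)})
  rw [vSplit_asIdeal, ← under_eq_span_natCast K p h1 P]
  exact ncard_primesOver_vOf K p h1 P

omit P in
include h1 in
/-- Two distinct places of `ℚ(i)` lie over `vSplit`. -/
theorem exists_ne_liesOver_vSplit :
    haveI := numberField K; haveI := isCMField_four K
    ∃ w₁ w₂ : HeightOneSpectrum (𝓞 K), w₁ ≠ w₂ ∧ w₁.asIdeal.LiesOver (vSplit K p h1).asIdeal ∧
      w₂.asIdeal.LiesOver (vSplit K p h1).asIdeal := by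
  haveI := numberField K
  haveI := isCMField_four K
  obtain ⟨x, z, hxz, hs⟩ := Set.ncard_eq_two.mp (ncard_primesOver_vSplit K p h1)
  have hx : x ∈ (vSplit K p h1).asIdeal.primesOver (𝓞 K) := by rw [hs]; exact Set.mem_insert x _
  have hz : z ∈ (vSplit K p h1).asIdeal.primesOver (𝓞 K) := by rw [hs]; exact Set.mem_insert_of_mem x rfl
  haveI := hx.1
  haveI := hx.2
  haveI := hz.1
  haveI := hz.2
  refine ⟨⟨x, hx.1, Ideal.ne_bot_of_liesOver_of_ne_bot (vSplit K p h1).ne_bot x⟩,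
    ⟨z, hz.1, Ideal.ne_bot_of_liesOver_of_ne_bot (vSplit K p h1).ne_bot z⟩, ?_, hx.2, hz.2⟩
  intro h
  exact hxz (congrArg HeightOneSpectrum.asIdeal h)

omit P in
include h1 in
/-- **THE RECORD'S SPHERICAL HECKE ALGEBRA ON `ℚ(i)` AT EVERY SPLIT PLACE `(p)` IS COMMUTATIVE**: for every family
`l` of generators of `𝓞_{ℚ(i)}` over `𝓞_{ℚ(i)⁺}` and every field `k`, `H(U(1 ⊗ H₀), K_{(p)})` is commutative
(file 250's `heckeAlgebra_mul_comm_record_of_ne_of_liesOver` on the two places above `(p)`). -/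
theorem heckeAlgebra_mul_comm_record_four_split (k : Type*) [Field k] {r : ℕ} (l : Fin r → 𝓞 K)
    (hl : Submodule.span (𝓞 (maximalRealSubfield K)) (Set.range l) = ⊤)
    (T S : (haveI := numberField K; haveI := isCMField_four K; letI := tensorStarRing K (vSplit K p h1);
      ↥(heckeAlgebra k (recordHyperspecial K (vSplit K p h1) l (gramToy K))))) :
    T * S = S * T :=
  haveI := numberField K
  haveI := isCMField_four K
  (exists_ne_liesOver_vSplit K p h1).elim fun w₁ h => h.elim fun w₂ h =>
    @heckeAlgebra_mul_comm_record_of_ne_of_liesOver K _ (numberField K) (isCMField_four K) (vSplit K p h1) w₁ w₂ _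
      l k _ hl h.1 h.2.1 h.2.2 _ _ _ _ gramToy_isHermitian isUnit_det_gramToy (notMem_badSet_gramToy _) T S

omit P in
include h1 in
/-- **With the generators supplied** (file 235's `exists_fin_span_eq_top`): the split branch of the census is
inhabited on the field of record at every such place. -/
theorem exists_generators_and_heckeAlgebra_mul_comm_record_four_split (k : Type*) [Field k] :
    haveI := numberField K; haveI := isCMField_four K
    ∃ (r : ℕ) (l : Fin r → 𝓞 K), Submodule.span (𝓞 (maximalRealSubfield K)) (Set.range l) = ⊤ ∧
      ∀ T S : (letI := tensorStarRing K (vSplit K p h1);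
          ↥(heckeAlgebra k (recordHyperspecial K (vSplit K p h1) l (gramToy K)))), T * S = S * T :=
  haveI := numberField K
  haveI := isCMField_four K
  (exists_fin_span_eq_top K).elim fun r h => h.elim fun l hl =>
    ⟨r, l, hl, fun T S => heckeAlgebra_mul_comm_record_four_split K p h1 k l hl T S⟩

end Place


section Instances

variable (K : Type*) [Field K] [CharZero K] [IsCyclotomicExtension {2 ^ 2} ℚ K]

/-- `5` has multiplicative order `1` modulo `4`. -/
theorem orderOf_natCast_five_zmod_four : orderOf ((5 : ℕ) : ZMod (2 ^ 2)) = 1 := by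
  rw [orderOf_eq_iff (by norm_num)]
  decide

/-- `13` has multiplicative order `1` modulo `4`. -/
theorem orderOf_natCast_thirteen_zmod_four : orderOf ((13 : ℕ) : ZMod (2 ^ 2)) = 1 := by
  rw [orderOf_eq_iff (by norm_num)]
  decide

/-- `5` is prime (as a `Fact`, for the generic theorems). -/
theorem fact_prime_five' : Fact (Nat.Prime 5) := ⟨by norm_num⟩

/-- `13` is prime (as a `Fact`, for the generic theorems). -/
theorem fact_prime_thirteen : Fact (Nat.Prime 13) := ⟨by norm_num⟩

/-- **`(5)` of `ℚ(i)⁺` has exactly two places of `ℚ(i)` above it** (seat p8's T5-164 `wFiveA ≠ wFiveB` and file 250's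
`ncard_primesOver_vFivePlus` re-derived from the inertia degree). -/
theorem ncard_primesOver_vSplit_five :
    haveI := numberField K; haveI := isCMField_four K; haveI := fact_prime_five'
    ((vSplit K 5 orderOf_natCast_five_zmod_four).asIdeal.primesOver (𝓞 K)).ncard = 2 := by
  haveI := numberField K
  haveI := isCMField_four K
  haveI := fact_prime_five'
  exact ncard_primesOver_vSplit K 5 orderOf_natCast_five_zmod_four

/-- **`(13)` of `ℚ(i)⁺` has exactly two places of `ℚ(i)` above it**, and `N(v) = 13`. -/
theorem ncard_primesOver_vSplit_thirteen_and_absNorm :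
    haveI := numberField K; haveI := isCMField_four K; haveI := fact_prime_thirteen
    ((vSplit K 13 orderOf_natCast_thirteen_zmod_four).asIdeal.primesOver (𝓞 K)).ncard = 2 ∧
      Ideal.absNorm (vSplit K 13 orderOf_natCast_thirteen_zmod_four).asIdeal = 13 := by
  haveI := numberField K
  haveI := isCMField_four K
  haveI := fact_prime_thirteen
  exact ⟨ncard_primesOver_vSplit K 13 orderOf_natCast_thirteen_zmod_four,
    absNorm_vSplit K 13 orderOf_natCast_thirteen_zmod_four⟩

end Instances

end Summit.Ventures.HodgeRepro2.T5CyclotomicFourSplitPrime
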